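import Summits.AtomisticToContinuum.HydrodynamicLimit.Theses.InformationPercolationEngine
import Literature.MathematicalPhysics.KineticTheory.TaggedSphereCarleman
import Literature.Probability.Distributions.GaussianSphereMarginal
import Summits.AtomisticToContinuum.HydrodynamicLimit.Theorems.SpectralContractionR.Negative.WithoutMeanZero
import Summits.AtomisticToContinuum.HydrodynamicLimit.Theorems.SpectralContractionR.Negative.WithoutMeasurable
import Summits.AtomisticToContinuum.HydrodynamicLimit.Theorems.SpectralContractionR.Negative.WithoutIntegrableSpikes
import Summits.AtomisticToContinuum.HydrodynamicLimit.Theorems.SpectralContractionR.Negative.WithoutIntegrableWitness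

/-!
# `SpectralContractionR` is false without its integrability hypothesis (load-bearing analysis, 3/3)

Negative knowledge for the crux `InformationPercolationEngine.SpectralContractionR`
(stmt-AtomisticToContinuum-13913), from the standing disprover's `Cruxes/SpectralContractionR/Disproof.lean`.
`SpectralContractionRWithoutIntegrable` is the crux VERBATIM with the hypothesis
`MeasureTheory.Integrable (fun v => f v ^ 2 * (ν v * M v))` deleted, and it is FALSE:

* WITNESS `f = g - m`, `g = Σ_n 2^{7(n+1)} 1_{|v| < 2^{-4(n+1)}}` (files 1–2: `WithoutIntegrableSpikes`,
  `WithoutIntegrableWitness`). `g` is measurable, `g ∈ L¹(νM)` but `g ∉ L²(νM)` (`not_integrable_f_sq` below: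
  on `B(0, r_N)` the integrand is `≥ (a_N/2)² inf_{B₁} νM` and `a_N² r_N³ = 4^{N+1} → ∞`), so the mean-zero
  hypothesis is HONEST while the right side `c · ∫ f² νM` is the Bochner junk `c · 0 = 0`.
* The typed `K f` is the HONEST Carleman average `ν⁻¹ ∫ k₁ g - m` (`K_f_eq`, file 2), bounded, measurable and
  `≤ -m/2` outside a large ball, so `∫ (K f)² νM` is an honest POSITIVE number (`integral_Kf_sq_pos`) —
  contradicting `≤ 0`.

Hence ANY proof of the crux must use the `L²(π)` hypothesis (it is what makes the right side honest); together
with `Negative/WithoutMeanZero.lean` and `Negative/WithoutMeasurable.lean` this completes the load-bearing analysis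
of all three hypotheses on `f` (the fourth datum, `c < 1/2`, is what the route consumes; with `c = 1` the
statement is the trivial `L²(π)`-contraction). refuter-cdisprove-stmt-AtomisticToContinuum-13913-0.
-/

noncomputable section

open MeasureTheory Metric Real Set Filter Topology ProbabilityTheory
open scoped InnerProductSpace ENNReal

namespace Summit.AtomisticToContinuum.HydrodynamicLimit.Theorems

namespace SpectralContractionRWithoutIntegrable

open Literature.MathematicalPhysics.KineticTheory
open Literature.Analysis.FunctionSpaces (maxwellianBeta maxwellianBeta_one maxwellianBeta_pos)
open Literature.Analysis.FluidPDE (globalMaxwellian globalMaxwellian_pos)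
open SpectralContractionRWithoutMeanZero (nu_eq nu_pos integrable_nuM integral_nuM_pos)
open SpectralContractionRWithoutMeasurable (measurable_nuM)

/-! ### `f ∉ L²(νM)`: the RIGHT side of the crux is Bochner junk `c · 0` -/

/-- `f² νM` is NOT integrable: on `B(0, r_N)` it is `≥ (a_N/2)² inf_{B₁} νM`, and `a_N² r_N³ = 4^{N+1}`.
[folklore] -/
theorem not_integrable_f_sq :
    ¬ Integrable (fun v : V3 => f v ^ 2 *
      ((∫ w, ∫ ω, hardSphereKernel (v, w) ω * globalMaxwellian w ∂sphereMeasure) * globalMaxwellian v)) := by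
  intro hI
  obtain ⟨c₀, hc₀, hlow⟩ := exists_le_nuM_on_ball
  set L := ∫⁻ v : V3, ‖f v ^ 2 *
      ((∫ w, ∫ ω, hardSphereKernel (v, w) ω * globalMaxwellian w ∂sphereMeasure) * globalMaxwellian v)‖ₑ with hL
  have hLfin : L < ∞ := hI.2
  -- lower bound on every small ball on which the spike dominates the shift
  have hlb : ∀ N : ℕ, 2 * mShift ≤ ampR N →
      ENNReal.ofReal (c₀ / 4 * (2 : ℝ) ^ (2 * (N + 1))) * volume (ball (0 : V3) 1) ≤ L := by
    intro N hN
    have hae : ∀ᵐ v ∂(volume.restrict (ball (0 : V3) (rad N))),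
        ENNReal.ofReal (ampR N ^ 2 / 4 * c₀) ≤ ‖f v ^ 2 *
          ((∫ w, ∫ ω, hardSphereKernel (v, w) ω * globalMaxwellian w ∂sphereMeasure) * globalMaxwellian v)‖ₑ := by
      have h0 : ∀ᵐ v ∂(volume : Measure V3), v ∉ ({0} : Set V3) :=
        compl_mem_ae_iff.2 (measure_singleton 0)
      filter_upwards [ae_restrict_mem measurableSet_ball, ae_restrict_of_ae h0] with v hv hv0
      rw [Set.mem_singleton_iff] at hv0
      have hgv : ampR N ≤ g v := ampR_le_g hv0 hv
      have hfv : ampR N / 2 ≤ f v := by unfold f; linarith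
      have hfv0 : 0 ≤ f v := le_trans (by linarith [ampR_pos N]) hfv
      have hball : v ∈ closedBall (0 : V3) 1 := by
        rw [mem_closedBall_zero_iff]
        exact ((mem_ball_zero_iff.1 hv).trans_le (rad_le_one N)).le
      have hνM := hlow v hball
      rw [Real.enorm_of_nonneg (mul_nonneg (sq_nonneg _) (nuM_pos v).le)]
      apply ENNReal.ofReal_le_ofReal
      have hsq : ampR N ^ 2 / 4 ≤ f v ^ 2 := by
        have h' := pow_le_pow_left₀ (by linarith [ampR_pos N] : 0 ≤ ampR N / 2) hfv 2
        calc ampR N ^ 2 / 4 = (ampR N / 2) ^ 2 := by ring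
          _ ≤ f v ^ 2 := h'
      exact mul_le_mul hsq hνM hc₀.le (sq_nonneg _)
    calc ENNReal.ofReal (c₀ / 4 * (2 : ℝ) ^ (2 * (N + 1))) * volume (ball (0 : V3) 1)
        = ENNReal.ofReal (ampR N ^ 2 / 4 * c₀) * volume (ball (0 : V3) (rad N)) := by
          rw [Measure.addHaar_ball volume _ (rad_pos N).le, finrank_euclideanSpace_fin, ← mul_assoc,
            ← ENNReal.ofReal_mul (by positivity), ← ampR_sq_mul_rad_cube]
          congr 2; ring
      _ = ∫⁻ _ in ball (0 : V3) (rad N), ENNReal.ofReal (ampR N ^ 2 / 4 * c₀) := by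
          rw [setLIntegral_const]
      _ ≤ ∫⁻ v in ball (0 : V3) (rad N), ‖f v ^ 2 *
          ((∫ w, ∫ ω, hardSphereKernel (v, w) ω * globalMaxwellian w ∂sphereMeasure) * globalMaxwellian v)‖ₑ :=
          lintegral_mono_ae hae
      _ ≤ L := setLIntegral_le_lintegral _ _
  -- choose N beating both thresholds
  obtain ⟨n₁, hn₁⟩ : ∃ n : ℕ, 2 * mShift < (2 : ℝ) ^ n := pow_unbounded_of_one_lt _ one_lt_two
  obtain ⟨n₂, hn₂⟩ : ∃ n : ℕ, L.toReal / ((volume (ball (0 : V3) 1)).toReal * (c₀ / 4)) < (2 : ℝ) ^ n :=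
    pow_unbounded_of_one_lt _ one_lt_two
  set N := max n₁ n₂ with hN
  have hvolpos : 0 < (volume (ball (0 : V3) 1)).toReal :=
    ENNReal.toReal_pos (measure_ball_pos _ _ one_pos).ne' measure_ball_lt_top.ne
  have h1 : 2 * mShift ≤ ampR N := by
    refine hn₁.le.trans ?_
    unfold ampR
    exact pow_le_pow_right₀ one_le_two (by omega)
  have h2 : L.toReal / ((volume (ball (0 : V3) 1)).toReal * (c₀ / 4)) < (2 : ℝ) ^ (2 * (N + 1)) :=
    hn₂.trans_le (pow_le_pow_right₀ one_le_two (by omega))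
  have h3 := hlb N h1
  have h4 : (ENNReal.ofReal (c₀ / 4 * (2 : ℝ) ^ (2 * (N + 1))) * volume (ball (0 : V3) 1)).toReal ≤ L.toReal :=
    ENNReal.toReal_mono hLfin.ne h3
  rw [ENNReal.toReal_mul, ENNReal.toReal_ofReal (by positivity)] at h4
  rw [div_lt_iff₀ (by positivity)] at h2
  nlinarith

/-! ### The LEFT side is an honest positive number -/

/-- `∫ (K f)² νM > 0`: the honest `K f` is bounded (so the integral is not junk) and `≤ -m/2` on the
complement of a ball, which has positive `νM`-mass. [folklore] -/
theorem integral_Kf_sq_pos :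
    0 < ∫ v : V3, ((∫ w, ∫ ω, hardSphereKernel (v, w) ω * globalMaxwellian w ∂sphereMeasure)⁻¹ *
        (∫ u, carlemanKernel 1 v u * g (v + u)) - mShift) ^ 2 *
      ((∫ w, ∫ ω, hardSphereKernel (v, w) ω * globalMaxwellian w ∂sphereMeasure) * globalMaxwellian v) := by
  obtain ⟨B, R₀, hR₀, hB, hfar⟩ := Kf_estimates
  have hm := mShift_pos
  have hmeasK : Measurable fun v : V3 => (∫ w, ∫ ω, hardSphereKernel (v, w) ω * globalMaxwellian w ∂sphereMeasure)⁻¹ *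
      (∫ u, carlemanKernel 1 v u * g (v + u)) - mShift := by
    have hν : Measurable fun v : V3 => ∫ w, ∫ ω, hardSphereKernel (v, w) ω * globalMaxwellian w ∂sphereMeasure := by
      have : (fun v : V3 => ∫ w, ∫ ω, hardSphereKernel (v, w) ω * globalMaxwellian w ∂sphereMeasure) =
          TaggedSphereDiffusion.collisionFrequency (d := Fin 3) 1 := funext nu_eq
      rw [this]; exact (continuous_collisionFrequency one_pos).measurable
    exact (hν.inv.mul measurable_Cg).sub measurable_const
  -- integrability of the left integrand (bounded × νM)
  have hint : Integrable fun v : V3 => ((∫ w, ∫ ω, hardSphereKernel (v, w) ω * globalMaxwellian w ∂sphereMeasure)⁻¹ *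
        (∫ u, carlemanKernel 1 v u * g (v + u)) - mShift) ^ 2 *
      ((∫ w, ∫ ω, hardSphereKernel (v, w) ω * globalMaxwellian w ∂sphereMeasure) * globalMaxwellian v) := by
    refine (integrable_nuM.const_mul (B ^ 2)).mono' ((hmeasK.pow_const 2).mul measurable_nuM).aestronglyMeasurable
      (Eventually.of_forall fun v => ?_)
    rw [Real.norm_eq_abs, abs_mul, abs_of_nonneg (sq_nonneg _), abs_of_nonneg (nuM_pos v).le]
    refine mul_le_mul_of_nonneg_right ?_ (nuM_pos v).le
    rw [← sq_abs]
    exact pow_le_pow_left₀ (abs_nonneg _) (hB v) 2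
  -- comparison with (m/2)² 1_{|v| ≥ R₀} νM
  set S : Set V3 := {v | R₀ ≤ ‖v‖} with hS
  have hSm : MeasurableSet S := measurableSet_le measurable_const measurable_norm
  have hind : Integrable fun v : V3 => S.indicator (fun v => (mShift / 2) ^ 2 *
      ((∫ w, ∫ ω, hardSphereKernel (v, w) ω * globalMaxwellian w ∂sphereMeasure) * globalMaxwellian v)) v :=
    (integrable_nuM.const_mul _).indicator hSm
  have hle : ∫ v, S.indicator (fun v => (mShift / 2) ^ 2 *
      ((∫ w, ∫ ω, hardSphereKernel (v, w) ω * globalMaxwellian w ∂sphereMeasure) * globalMaxwellian v)) v ≤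
      ∫ v : V3, ((∫ w, ∫ ω, hardSphereKernel (v, w) ω * globalMaxwellian w ∂sphereMeasure)⁻¹ *
        (∫ u, carlemanKernel 1 v u * g (v + u)) - mShift) ^ 2 *
      ((∫ w, ∫ ω, hardSphereKernel (v, w) ω * globalMaxwellian w ∂sphereMeasure) * globalMaxwellian v) := by
    refine integral_mono hind hint fun v => ?_
    by_cases hv : v ∈ S
    · rw [Set.indicator_of_mem hv]
      refine mul_le_mul_of_nonneg_right ?_ (nuM_pos v).le
      have h := hfar v hv
      nlinarith
    · rw [Set.indicator_of_notMem hv]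
      exact mul_nonneg (sq_nonneg _) (nuM_pos v).le
  refine lt_of_lt_of_le ?_ hle
  rw [integral_indicator hSm, integral_const_mul]
  refine mul_pos (by positivity) ?_
  have hnn : 0 ≤ᵐ[volume.restrict S] fun v : V3 =>
      (∫ w, ∫ ω, hardSphereKernel (v, w) ω * globalMaxwellian w ∂sphereMeasure) * globalMaxwellian v :=
    Eventually.of_forall fun v => (nuM_pos v).le
  rw [setIntegral_pos_iff_support_of_nonneg_ae hnn integrable_nuM.integrableOn]
  have hsupp : Function.support (fun v : V3 =>
      (∫ w, ∫ ω, hardSphereKernel (v, w) ω * globalMaxwellian w ∂sphereMeasure) * globalMaxwellian v) = Set.univ := by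
    ext v; simp only [Function.mem_support, Set.mem_univ, iff_true]; exact (nuM_pos v).ne'
  rw [hsupp, Set.univ_inter]
  -- S contains a ball far away
  obtain ⟨e, he1⟩ := exists_norm_eq V3 zero_le_one
  have hsub : ball ((3 * R₀) • e) R₀ ⊆ S := by
    intro v hv
    rw [mem_ball, dist_eq_norm] at hv
    show R₀ ≤ ‖v‖
    have h1 : ‖(3 * R₀) • e‖ = 3 * R₀ := by
      rw [norm_smul, he1, mul_one, Real.norm_of_nonneg (by positivity)]
    have h2 : ‖(3 * R₀) • e‖ ≤ ‖v‖ + ‖v - (3 * R₀) • e‖ := by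
      calc ‖(3 * R₀) • e‖ = ‖v - (v - (3 * R₀) • e)‖ := by rw [sub_sub_cancel]
        _ ≤ ‖v‖ + ‖v - (3 * R₀) • e‖ := norm_sub_le _ _
    linarith
  exact lt_of_lt_of_le (measure_ball_pos _ _ hR₀) (measure_mono hsub)

end SpectralContractionRWithoutIntegrable

open SpectralContractionRWithoutIntegrable in
/-- The crux `SpectralContractionR` with the INTEGRABILITY hypothesis `Integrable (f² νM)` dropped
(all else verbatim). -/
def SpectralContractionRWithoutIntegrable : Prop :=
  ∃ c : ℝ, c < 1 / 2 ∧ let M : Literature.MathematicalPhysics.KineticTheory.V3 → ℝ := Literature.Analysis.FluidPDE.globalMaxwellian; let S : MeasureTheory.Measure (Metric.sphere (0 : Literature.MathematicalPhysics.KineticTheory.V3) 1) := Literature.MathematicalPhysics.KineticTheory.sphereMeasure; let ν : Literature.MathematicalPhysics.KineticTheory.V3 → ℝ := fun v => ∫ w, ∫ ω, Literature.MathematicalPhysics.KineticTheory.hardSphereKernel (v, w) ω * M w ∂S; let K : (Literature.MathematicalPhysics.KineticTheory.V3 → ℝ) → Literature.MathematicalPhysics.KineticTheory.V3 → ℝ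 := fun f v => (ν v)⁻¹ * ∫ w, ∫ ω, Literature.MathematicalPhysics.KineticTheory.hardSphereKernel (v, w) ω * M w * f (Literature.MathematicalPhysics.KineticTheory.collide ω (v, w)).1 ∂S; ∀ f : Literature.MathematicalPhysics.KineticTheory.V3 → ℝ, Measurable f → ∫ v, f v * (ν v * M v) = 0 → ∫ v, K f v ^ 2 * (ν v * M v) ≤ c * ∫ v, f v ^ 2 * (ν v * M v)

open SpectralContractionRWithoutIntegrable in
/-- ANY PROOF OF THE CRUX MUST USE `Integrable (f² νM)`: without it the radial spike sum `f = g - m`,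
`g = Σ_n 2^{7(n+1)} 1_{|v| < 2^{-4(n+1)}}` (measurable, `g ∈ L¹(νM) \ L²(νM)`, honest mean zero) makes
the right side Bochner junk `c · 0 = 0` while the typed `K f` is the HONEST, bounded Carleman average
`ν⁻¹ ∫ k₁ g - m` (`K_f_eq`), which is `≤ -m/2` outside a large ball, so the left side is `> 0`. [folklore] -/
theorem spectralContractionR_false_without_integrable : ¬ SpectralContractionRWithoutIntegrable := by
  rintro ⟨c, -, h⟩
  have h1 := h f measurable_f integral_f_nuM
  simp only [K_f_eq] at h1
  rw [integral_undef not_integrable_f_sq, mul_zero] at h1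
  exact absurd h1 (not_le.2 integral_Kf_sq_pos)

end Summit.AtomisticToContinuum.HydrodynamicLimit.Theorems

end
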